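import Mathlib
import Literature.MathematicalPhysics.QuantumFieldTheory.Volkov2017.DominatedToyMoments
import Literature.MathematicalPhysics.QuantumFieldTheory.Volkov2017.DominatedToyDivergence
import Literature.MathematicalPhysics.QuantumFieldTheory.Volkov2020.SpeerFormHalf
import HarnessLib

/-!
# Volkov's 2018/2019 MIXTURE sampling density `g = C₁g₁ + C₂g₂ + C₃g₃ + C₄g₄` (PRD 98, 076018 §IV E; PRD 100, 096004 eq. (13)): the second moment of the weight under a mixture is at most `C_j⁻¹` times that under any component — hence, by exponents, WHERE the printed construction does guarantee a finite variance (a Speer-form sector bound with exponents `> D/2` under the constant-exponent component `g₃`, `Deg ≡ D = 0.75`; in particular on NPB 961 Theorem 3.1's class, exponents `≥ ½`)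

independent recomputation; certified where stated, statistical where stated; no new-physics claim.

CITATION HEADER (venture `QEDPrecision`, cell `pub-qed`, track TROPICAL seat V3a = `pub-qed-trop-v3-lit-1` gen 11; VALUE-FREE:
inequalities between integrals of ABSTRACT functions on a measure space / on the unit cube, and arithmetic on three printed METHOD
constants (`D = 0.75`, `C₃ = 0.035` / `0.01`); no Feynman graph, no integral of any graph, nothing per Set V family or word).
Companion of `Volkov2017/DominatedToyMoments.lean` (V3a g9: on Ω = (0,1]ⁿ, `|f| ≤ C·fToyN a` and `0 < b_j < 2a_j` ⇒ `f²/gToyN b ∈ L¹`),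
`Volkov2017/DominatedToyDivergence.lean` (V3a g10: the converse for integrands bounded below near one edge),
`Volkov2017/OptimalSamplingDensity.lean` (V3a g10: `V(f,g) ≥ (∫|f|)² − (∫f)²` for every density) and `Volkov2020/SpeerFormHalf.lean`
(V3b g6: Theorem 3.1's exponents `max(⌈−ω⌉ − ½, ½) ≥ ½`). The question this file serves (`tropical/view/V3-VOLKOV-DEGREES.md` §A, payload
item «where his construction guarantees FINITE MEAN but NOT FINITE VARIANCE»): §A A.4/A.5 record that a finite VARIANCE is asserted
NOWHERE in Volkov 2015–2019. This file types the one mechanism in those texts that CAN deliver it, and the exponent inequality it needs.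

Sources, VERBATIM.
* [Volkov2018] S. Volkov, Phys. Rev. D 98, 076018 (2018) = arXiv:1807.05281 (e-print `amm4gpu_arxiv.tex`, HOME `data/lit/sources/.cache/1807.05281/`),
  §IV E «Modified probability density functions» (l.1006–1043; arXiv v2 p.19–20): «It is theoretically possible the situation when g(z) from
  (12) is very small, but the smallness of |I(z)| does not correspond to it. An emergence of such situations can make the Monte Carlo
  convergence worse. For patching it we use the probability density functions g(z) = C₁g₁(z) + C₂g₂(z) + C₃g₃(z) + C₄g₄(z) instead of
  (13), (14), where g₁ is defined by (13), (14), g₂(z₁,…,z_n) = Π_{l=2}^n [Deg({j_l,…,j_n})(z_{j_l}/z_{j_{l−1}})^{Deg({j_l,…,j_n})}] /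
  (n! z₁z₂…z_n) …, g₃ is defined by (13), (14), but with same Deg(s) = D, g₄(z) = (n−1)! (the uniform distribution). … All computations
  are performed with the following values for the constants: D = 0.75, C₂ = 0.03, C₃ = 0.035, C₄ = 0.035, C₁ = 1 − C₂ − C₃ − C₄.»
  Here (13) is `g₀ = Π_{l=2}^n (z_{j_l}/z_{j_{l−1}})^{Deg({j_l,…,j_n})} / (z₁…z_n)` on the sector `z_{j₁} ≥ … ≥ z_{j_n}` (§III, l.522).
* [Volkov2019] S. Volkov, Phys. Rev. D 100, 096004 (2019) = arXiv:1909.08015 (`amm5_arxiv.tex`), §III A eq. (13) `g = C₁g₁ + C₂g₂ + C₃g₃ + C₄g₄`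
  with (14) `g₁ = C·Π_{l=2}^M (z_{j_l}/z_{j_{l−1}})^{Deg({j_l,…,j_M})}/(z₁…z_M)`, «The stabilization functions g₂, g₃, g₄ are defined in
  Ref. [PRD 98]; an additional constant D is used for defining g₃.» (l.304–320); «A good upper bound can play the role of a good probability
  density function for Monte Carlo integration; see Ref. [PRD 96]. However, in the real case we should use a more complicated formulas for
  obtaining Deg(s). These formulas were developed for our calculations [footnote: However, a rigorous mathematical proof that the expressions
  of this form can be used as upper bounds for I(z) has not been obtained yet. The assurance is based on numerical experiments.]» (l.324);
  §V (l.416–429): «two calculations were performed … with different choices of the constants C₂, C₃, C₄ from (13) and the constant D that is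
  used for defining g₃ … Calc 1: … C₂ = 0.03, C₃ = 0.035, C₄ = 0.035, D = 0.75. Calc 2: … C₂ = 0.03, C₃ = 0.01, C₄ = 0.06, D = 0.75.»
* [Volkov2017] S. Volkov, Phys. Rev. D 96, 096018 (2017), §III A: `V(f,g) = ∫_Ω f²/g − (∫_Ω f)²` and the three cases (typed in the companions).
* [Volkov2020] S. Volkov, Nucl. Phys. B 961, 115232 (2020) = arXiv:1912.04885, §1 (l.121): «When f(z) is not square-integrable and the number
  of variables is large, the PDF should be chosen very accurately: on the one hand, an underestimation of the asymptotic growth rate near the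
  boundary even for one variable and for one sector leads to an infinite value ∫ f(z)²/g(z) dz and to poor and unstable convergence (as a
  consequence); on the other hand, a total overestimation of this growth rate leads to poor convergence too. Estimations like (1.9) with
  different asymptotic growth rates for different Hepp sectors are useful in this case.»; and the form of Theorem 3.1 (journal p.17; e-print
  «Theorem 1»): `|I′(z)| ≤ C·Π_{l=2}^{L} (z_{j_l}/z_{j_{l−1}})^{d_l} / (z₁…z_L)` on every Hepp sector, `d_l = max(⌈−ω(IClos({j_l,…,j_L}))⌉ − ½, ½)`,
  for magnetic-moment graphs WITHOUT lepton loops and WITHOUT UV-divergent subgraphs.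
* [Owen2013] A. B. Owen, *Monte Carlo theory, methods and examples*, Ch. 9 §9.11, (9.23)–(9.24): the mixture / defensive bound
  `∫ (fp)²/q_α ≤ α_j⁻¹ ∫ (fp)²/q_j` — typed on a FINITE sample space in `Literature/Probability/ImportanceSampling/DefensiveMixture.lean`
  (`isSecondMoment_mixture_le`); the Radon–Nikodym bounded-ratio form is `…/BoundedLikelihoodRatio.lean`. Section 1 below is the same
  one-line mechanism on a general measure space in Volkov's `f, g` vocabulary (densities w.r.t. a reference measure), which his continuous Ω needs;
  nothing of those files is re-declared.

WHAT IS PROVED (namespace `Literature.MathematicalPhysics.QuantumFieldTheory.Volkov2018`; 0 definitions, 0 named facts).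
§1 (general measure space `(X, μ)`, real `f, g, gⱼ`): `mul_le_mixtureDensity` (`C_j·g_j ≤ Σ_i C_i·g_i` for non-negative weights and
components); `sq_div_le_inv_mul_sq_div` (pointwise `f²/g ≤ c⁻¹·f²/g_j` when `0 < c·g_j ≤ g`); **`integrable_sq_div_of_mul_le`** and
**`integral_sq_div_le_of_mul_le`** (`c·g_j ≤ g` a.e., `g_j > 0` a.e., `f²/g_j ∈ L¹` ⇒ `f²/g ∈ L¹` and `∫ f²/g ≤ c⁻¹ ∫ f²/g_j`);
`dispersion_le_of_mul_le` (`V(f,g) ≤ c⁻¹∫f²/g_j − (∫f)²`); `integrable_sq_div_mixture` / `integral_sq_div_mixture_le` (the same for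
`g = Σ_i C_i g_i`, any component `j` with `C_j > 0`). READING: the 2018/2019 estimator has a finite variance as soon as the weight has a finite
second moment under ONE of `g₁ … g₄` taken alone — «patching» costs at most the factor `C_j⁻¹` (`1/0.035 ≈ 29`, `1/0.01 = 100` for `g₃`).
§2 (Volkov's sector model, Ω = (0,1]ⁿ in the variables `t_l = z_{j_l}/z_{j_{l−1}}` of one Hepp sector, the vocabulary `cube`, `fToyN`, `gToyN`
of the companions; PRD 96 §III B «the numbers Deg({j_l,…,j_n}) play the same role in the sector as b₁,…,b_n»): for an integrand with
`|F| ≤ K·fToyN a` (`= K·Π a_l t_l^{a_l−1}`, i.e. `|I|·Πz ≤ K′·Π t_l^{a_l}` on the sector) and ANY density with `g ≥ c·gToyN b` there (`c > 0`):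
**`sq_div_integrable_of_dominated_of_density_ge`** (`0 < b_l < 2a_l` ⇒ `F²/g ∈ L¹(Ω)`), its constant-exponent case
**`sq_div_integrable_of_dominated_of_constDeg`** (`b ≡ D`, `0 < D < 2a_l`: the `g₃` component), and the bounded-weight case
**`abs_weight_le_of_dominated_of_density_ge`** (`b = a` ⇒ `|F/g| ≤ K/c` on Ω: PRD 100's «a good upper bound can play the role of a good
probability density function» made exact — an upper bound OF THE FORM (14) with the same `Deg` gives case 1).
§3 (printed constants): `v18_constDeg_lt_one` (`0.75 < 1`), `v18_C3_pos`, `v19_calc2_C3_pos`, the private arithmetic step `D < 1`, `a ≥ ½` ⇒ `D < 2a`,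
`v18_constDeg_lt_two_mul_thm31_exponent` (`0.75 < 2·max(w − ½, ½)` for every real `w` — NPB 961 Theorem 3.1's exponents clear the `g₃` bar),
and the assembled statement **`sq_div_integrable_of_speerForm_half_of_constDeg`**: a Speer-form sector bound with all exponents `≥ ½` and a
density `≥ c·gToyN(D)` with `c > 0`, `0 < D < 1` give `F²/g ∈ L¹(Ω)`.
§4 (follow-up, appended after the first landing; adds the import of `DominatedToyDivergence` for its `momentN_toy_integrable_iff`): the same
transfer for the k-th absolute moment `∫ |f/g|^k g`, `k ≥ 1` (`abs_div_rpow_mul_le_of_mul_le`, **`integrable_abs_div_rpow_mul_of_mul_le`**: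
`≤ c^{1−k}·∫ |f/g_j|^k g_j`), and in the sector model **`rpow_weight_integrable_of_dominated_of_density_ge`** (`(k−1)·b_l < k·a_l` ∀ l ⇒ finite
k-th moment under any density `≥ c·gToyN b`) with **`rpow_weight_integrable_of_dominated_of_constDeg_le`** (`a_l ≥ D` ∀ l ⇒ ALL moments `k ≥ 1`
finite under any density `≥ c·gToyN(D)`) — the tail-index reading: under a mixture the weight's critical moment order on a toy-comparable
sector is at least `min_l b_l/(b_l − a_l)₊` for EVERY component `b` present with positive weight, in particular `≥ min_l D/(D − a_l)₊` from `g₃`.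
§5 (second follow-up): the DIVERGENCE direction for a density only known to be dominated ABOVE by a toy component near ONE edge —
**`sq_div_not_integrable_of_le_on_box_of_density_le`** (box `B ⊆ Ω` reaching the face `x_{j₀} = 0`, `c·fToyN a ≤ |f|` and `g ≤ K·gToyN b` on `B`,
`g > 0` on Ω, `2a_{j₀} ≤ b_{j₀}` ⇒ `f²/g ∉ L¹(Ω)`; proof: truncate `f` to `B` and use the companion's `sq_div_gToyN_not_integrable_of_le_on_box`)
and its whole-cube case `sq_div_not_integrable_of_le_of_density_le` — for a mixture on a tube at one edge every Hepp-table component is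
`≍ x_{j₀}^{b^{(i)}_{j₀}−1}`, so `b_{j₀}` there is the componentwise MINIMUM edge exponent (an edge statement; on corners the minimum is ray-wise).

THE TRACK'S READING (⟦lit⟧, `V3-VOLKOV-DEGREES.md` A.26; stated, not asserted beyond the theorems). (i) WHERE A FINITE VARIANCE IS
GUARANTEED BY THE PRINTS, though printed in none of them: on NPB 961 Theorem 3.1's class (no lepton loops, NO UV-divergent subgraph —
0 of the 254 IR/SE words' vertex graphs, §A A.7) the integrand obeys a sector-wise Speer-form bound with `d_l ≥ ½`, so under the 2018/2019
mixture (component `C₃g₃`, `D = 0.75 < 1 ≤ 2d_l`, `C₃ > 0`) the weight has a finite second moment sector by sector (§3), and under the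
table law with `Deg := d` it is even BOUNDED (§2, case 1). (ii) For a SUBTRACTED integrand the same algebra says: finite variance under the
2018/2019 mixture ⇐ a sector-wise bound `|I|·Πz ≤ K·Π t_l^{a_l}` with every `a_l > D/2 = 0.375`; bounded weights under pure `g₁` ⇐ the same
with `a_l ≥ Deg_l` — and NO such sector-wise bound is printed for any graph with a UV-divergent subgraph (ZhETF 149 (2016) proves `→ 0`
along rays only; PRD 100's footnote above; PRD 110 (2024) reports «examples of high order … that result in an infinite integral» ∫I²/g₀ —
§B's paper). (iii) The converse direction (an edge where the true exponent is `≤ D/2`, attained on a tube ⇒ infinite second moment under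
`g₃` alone) is `Volkov2017/DominatedToyDivergence.lean`; for the MIXTURE a lower bound needs all four components and is not typed.
NOT typed: the change of variables simplex → sector cube (`Volkov2017/SectorIntegral.lean`, `Borinsky2020/HeppSectorCoordinates.lean`
hold the pieces); Theorem 3.1 itself; `g₂`/`g₄`'s sector exponents; anything per graph or word.
-/

noncomputable section

open MeasureTheory

namespace Literature.MathematicalPhysics.QuantumFieldTheory.Volkov2018

/-! ## §1 A mixture density dominates each of its components (general measure space) -/

section General

variable {X : Type*}

/-- A mixture with non-negative weights and non-negative components dominates each weighted component pointwise:
`C_j·g_j(x) ≤ Σ_i C_i·g_i(x)`. [cite: Volkov2018, §IV E «g = C₁g₁ + C₂g₂ + C₃g₃ + C₄g₄» (arXiv:1807.05281 l.1012–1015)] -/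
theorem mul_le_mixtureDensity {ι : Type*} [Fintype ι] (C : ι → ℝ) (G : ι → X → ℝ)
    (hC : ∀ i, 0 ≤ C i) (hG : ∀ i x, 0 ≤ G i x) (j : ι) (x : X) :
    C j * G j x ≤ ∑ i, C i * G i x :=
  Finset.single_le_sum (f := fun i => C i * G i x) (fun i _ => mul_nonneg (hC i) (hG i x)) (Finset.mem_univ j)

/-- Pointwise mechanism of the mixture bound: if `0 < c`, `0 < g_j` and `c·g_j ≤ g` then `f²/g ≤ c⁻¹·(f²/g_j)`.
[cite: Owen2013, §9.11 (9.23)–(9.24) («p(x)/q_α(x) ≤ 1/α₁ … ∫ (f p)²/q_α ≤ ∫ (f p)²/(α₁ p)»)] -/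
theorem sq_div_le_inv_mul_sq_div {f g gj c : ℝ} (hc : 0 < c) (hgj : 0 < gj) (hle : c * gj ≤ g) :
    f ^ 2 / g ≤ c⁻¹ * (f ^ 2 / gj) :=
  calc f ^ 2 / g ≤ f ^ 2 / (c * gj) := div_le_div_of_nonneg_left (sq_nonneg f) (mul_pos hc hgj) hle
    _ = c⁻¹ * (f ^ 2 / gj) := by rw [div_mul_eq_div_div_swap, div_eq_mul_inv, mul_comm]

variable [MeasurableSpace X] {μ : Measure X}

/-- **Second-moment transfer from a dominated component.** On any measure space: if `c·g_j ≤ g` a.e. with `c > 0`, `g_j > 0` a.e., and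
`f²/g_j` is integrable, then `f²/g` is integrable — a finite second moment of the weight `f/g_j` under the component ALONE gives a finite
second moment of `f/g` under the mixture. [cite: Volkov2018, §IV E (the mixture «for patching», l.1006–1015); mechanism Owen2013 §9.11 (9.23)] -/
theorem integrable_sq_div_of_mul_le {f g gj : X → ℝ} {c : ℝ} (hc : 0 < c)
    (hf : AEStronglyMeasurable f μ) (hg : AEStronglyMeasurable g μ)
    (hpos : ∀ᵐ x ∂μ, 0 < gj x) (hle : ∀ᵐ x ∂μ, c * gj x ≤ g x)
    (hint : Integrable (fun x => f x ^ 2 / gj x) μ) :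
    Integrable (fun x => f x ^ 2 / g x) μ := by
  have hmeas : AEStronglyMeasurable (fun x => f x ^ 2 / g x) μ :=
    ((hf.aemeasurable.pow_const 2).div hg.aemeasurable).aestronglyMeasurable
  refine Integrable.mono' (hint.const_mul c⁻¹) hmeas ?_
  filter_upwards [hpos, hle] with x hx hxle
  have hgx : 0 < g x := lt_of_lt_of_le (mul_pos hc hx) hxle
  rw [Real.norm_eq_abs, abs_of_nonneg (div_nonneg (sq_nonneg _) hgx.le)]
  exact sq_div_le_inv_mul_sq_div hc hx hxle

/-- **The mixture bound, integrated**: under the hypotheses of `integrable_sq_div_of_mul_le`, `∫ f²/g ≤ c⁻¹·∫ f²/g_j`.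
[cite: Owen2013, §9.11 (9.23)–(9.24); applied to Volkov2018 §IV E's mixture] -/
theorem integral_sq_div_le_of_mul_le {f g gj : X → ℝ} {c : ℝ} (hc : 0 < c)
    (hf : AEStronglyMeasurable f μ) (hg : AEStronglyMeasurable g μ)
    (hpos : ∀ᵐ x ∂μ, 0 < gj x) (hle : ∀ᵐ x ∂μ, c * gj x ≤ g x)
    (hint : Integrable (fun x => f x ^ 2 / gj x) μ) :
    ∫ x, f x ^ 2 / g x ∂μ ≤ c⁻¹ * ∫ x, f x ^ 2 / gj x ∂μ := by
  rw [← integral_const_mul]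
  refine integral_mono_ae (integrable_sq_div_of_mul_le hc hf hg hpos hle hint) (hint.const_mul _) ?_
  filter_upwards [hpos, hle] with x hx hxle
  exact sq_div_le_inv_mul_sq_div hc hx hxle

/-- **Volkov's dispersion under a mixture**: `V(f,g) = ∫ f²/g − (∫ f)² ≤ c⁻¹·∫ f²/g_j − (∫ f)²` whenever `c·g_j ≤ g` a.e.
(PRD 96 §III A's `V`; PRD 98 §IV E's mixture). [cite: Volkov2018, §IV E (l.1006–1043); Volkov2017 §III A (eq_sigma) for V(f,g)] -/
theorem dispersion_le_of_mul_le {f g gj : X → ℝ} {c : ℝ} (hc : 0 < c)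
    (hf : AEStronglyMeasurable f μ) (hg : AEStronglyMeasurable g μ)
    (hpos : ∀ᵐ x ∂μ, 0 < gj x) (hle : ∀ᵐ x ∂μ, c * gj x ≤ g x)
    (hint : Integrable (fun x => f x ^ 2 / gj x) μ) :
    (∫ x, f x ^ 2 / g x ∂μ) - (∫ x, f x ∂μ) ^ 2 ≤ c⁻¹ * (∫ x, f x ^ 2 / gj x ∂μ) - (∫ x, f x ∂μ) ^ 2 :=
  sub_le_sub_right (integral_sq_div_le_of_mul_le hc hf hg hpos hle hint) _

/-- **The finite-family form**: for `g = Σ_i C_i g_i` with `C_i ≥ 0`, `g_i ≥ 0` (a.e.-strongly measurable), and one component `j` with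
`C_j > 0`, `g_j > 0` a.e. and `f²/g_j ∈ L¹`, the mixture has `f²/g ∈ L¹`. [cite: Volkov2018, §IV E («g = C₁g₁ + C₂g₂ + C₃g₃ + C₄g₄»,
«generate randomly j = 1,2,3,4, where the probability of selecting j is C_j», l.1012–1031)] -/
theorem integrable_sq_div_mixture {ι : Type*} [Fintype ι] {C : ι → ℝ} {G : ι → X → ℝ} {f : X → ℝ}
    (hC : ∀ i, 0 ≤ C i) (hG : ∀ i x, 0 ≤ G i x) (hGm : ∀ i, AEStronglyMeasurable (G i) μ)
    (hf : AEStronglyMeasurable f μ) {j : ι} (hCj : 0 < C j) (hpos : ∀ᵐ x ∂μ, 0 < G j x)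
    (hint : Integrable (fun x => f x ^ 2 / G j x) μ) :
    Integrable (fun x => f x ^ 2 / ∑ i, C i * G i x) μ :=
  integrable_sq_div_of_mul_le hCj hf
    (Finset.aestronglyMeasurable_fun_sum Finset.univ fun i _ => (hGm i).const_mul (C i)) hpos
    (ae_of_all _ fun x => mul_le_mixtureDensity C G hC hG j x) hint

/-- **The finite-family form, integrated**: `∫ f²/(Σ_i C_i g_i) ≤ C_j⁻¹·∫ f²/g_j`. [cite: Volkov2018, §IV E (l.1006–1043); Owen2013 §9.11 (9.24)] -/
theorem integral_sq_div_mixture_le {ι : Type*} [Fintype ι] {C : ι → ℝ} {G : ι → X → ℝ} {f : X → ℝ}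
    (hC : ∀ i, 0 ≤ C i) (hG : ∀ i x, 0 ≤ G i x) (hGm : ∀ i, AEStronglyMeasurable (G i) μ)
    (hf : AEStronglyMeasurable f μ) {j : ι} (hCj : 0 < C j) (hpos : ∀ᵐ x ∂μ, 0 < G j x)
    (hint : Integrable (fun x => f x ^ 2 / G j x) μ) :
    ∫ x, f x ^ 2 / (∑ i, C i * G i x) ∂μ ≤ (C j)⁻¹ * ∫ x, f x ^ 2 / G j x ∂μ :=
  integral_sq_div_le_of_mul_le hCj hf
    (Finset.aestronglyMeasurable_fun_sum Finset.univ fun i _ => (hGm i).const_mul (C i)) hpos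
    (ae_of_all _ fun x => mul_le_mixtureDensity C G hC hG j x) hint

end General

/-! ## §2 Volkov's sector model: integrands dominated by the toy, densities dominating a toy component -/

section SectorModel

open Volkov2017

variable {n : ℕ}

/-- `cube n`-almost every point lies in (0,1]ⁿ. [folklore] -/
private theorem ae_mem_cube : ∀ᵐ x ∂(cube n), ∀ j, x j ∈ Set.Ioc (0 : ℝ) 1 := by
  rw [cube_eq_restrict]
  filter_upwards [ae_restrict_mem (MeasurableSet.univ_pi fun _ => measurableSet_Ioc)] with x hx
  exact fun j => hx j (Set.mem_univ j)

/-- The toy density `gToyN b = Π b_j x_j^{b_j−1}` is positive on the open orthant when every `b_j > 0`. [folklore] -/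
private theorem gToyN_pos' (b x : Fin n → ℝ) (hb : ∀ j, 0 < b j) (hx : ∀ j, 0 < x j) : 0 < gToyN b x := by
  unfold gToyN gToy
  exact Finset.prod_pos fun j _ => mul_pos (hb j) (Real.rpow_pos_of_pos (hx j) _)

/-- The printed toy integrand and toy density are the same function of (exponent, point): `fToyN a = gToyN a`. [cite: Volkov2017, §III A
(l.541–549: f = Π a_j x_j^{a_j−1}, g = Π b_j x_j^{b_j−1})] -/
theorem fToyN_eq_gToyN (a x : Fin n → ℝ) : fToyN a x = gToyN a x := rfl

/-- **Finite second moment by exponents under ANY density dominating a toy component.** On Ω = (0,1]ⁿ (one Hepp sector in the variables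
`t_l = z_{j_l}/z_{j_{l−1}}`): if `|F| ≤ K·Π a_l t_l^{a_l−1}` and the density satisfies `g ≥ c·Π b_l t_l^{b_l−1}` with `c > 0` and
`0 < b_l < 2a_l` for every `l`, then `F²/g ∈ L¹(Ω)` — the weight `F/g` has a finite second moment on the sector («the numbers Deg({j_l,…,j_n})
play the same role in the sector … as b₁,…,b_n»; the mixture of PRD 98 §IV E dominates `C₁·g₁` and `C₃·g₃`).
[cite: Volkov2018, §IV E (l.1006–1043) with §III (13) (l.522); exponents: Volkov2017 §III A–B via `DominatedToyMoments`] -/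
theorem sq_div_integrable_of_dominated_of_density_ge {F g : (Fin n → ℝ) → ℝ}
    (hF : AEStronglyMeasurable F (cube n)) (hg : AEStronglyMeasurable g (cube n))
    {K c : ℝ} (hc : 0 < c) {a b : Fin n → ℝ} (hb : ∀ j, 0 < b j) (h2 : ∀ j, b j < 2 * a j)
    (hFle : ∀ x : Fin n → ℝ, (∀ j, x j ∈ Set.Ioc (0 : ℝ) 1) → |F x| ≤ K * fToyN a x)
    (hgge : ∀ x : Fin n → ℝ, (∀ j, x j ∈ Set.Ioc (0 : ℝ) 1) → c * gToyN b x ≤ g x) :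
    Integrable (fun x => F x ^ 2 / g x) (cube n) :=
  integrable_sq_div_of_mul_le hc hF hg
    (ae_mem_cube.mono fun x hx => gToyN_pos' b x hb fun j => (hx j).1)
    (ae_mem_cube.mono fun x hx => hgge x hx)
    (sq_div_gToyN_integrable_of_dominated hF hb h2 hFle)

/-- **The constant-exponent component `g₃` («g₃ is defined by (13), (14), but with same Deg(s) = D»).** If `|F| ≤ K·Π a_l t_l^{a_l−1}` on Ω
and `g ≥ c·Π D t_l^{D−1}` with `c > 0`, `0 < D` and `D < 2a_l` for every `l`, then `F²/g ∈ L¹(Ω)`.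
[cite: Volkov2018, §IV E («with same Deg(s) = D», «D = 0.75», l.1024–1042)] -/
theorem sq_div_integrable_of_dominated_of_constDeg {F g : (Fin n → ℝ) → ℝ}
    (hF : AEStronglyMeasurable F (cube n)) (hg : AEStronglyMeasurable g (cube n))
    {K c D : ℝ} (hc : 0 < c) (hD : 0 < D) {a : Fin n → ℝ} (h2 : ∀ j, D < 2 * a j)
    (hFle : ∀ x : Fin n → ℝ, (∀ j, x j ∈ Set.Ioc (0 : ℝ) 1) → |F x| ≤ K * fToyN a x)
    (hgge : ∀ x : Fin n → ℝ, (∀ j, x j ∈ Set.Ioc (0 : ℝ) 1) → c * gToyN (fun _ => D) x ≤ g x) :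
    Integrable (fun x => F x ^ 2 / g x) (cube n) :=
  sq_div_integrable_of_dominated_of_density_ge hF hg hc (fun _ => hD) h2 hFle hgge

/-- **Case 1 (bounded weight) from an upper bound OF THE FORM (14) with the SAME exponents** («A good upper bound can play the role of a good
probability density function»): if `|F| ≤ K·Π a_l t_l^{a_l−1}` and `g ≥ c·Π a_l t_l^{a_l−1}` on Ω with `K ≥ 0`, `c > 0`, `a_l > 0`, then
`|F/g| ≤ K/c` on Ω. [cite: Volkov2019, §III A (l.324: «A good upper bound can play the role of a good probability density function … a rigorous
mathematical proof that the expressions of this form can be used as upper bounds for I(z) has not been obtained yet»); Volkov2017 §III A case 1] -/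
theorem abs_weight_le_of_dominated_of_density_ge {F g : (Fin n → ℝ) → ℝ} {K c : ℝ} (hK : 0 ≤ K) (hc : 0 < c)
    {a : Fin n → ℝ} (ha : ∀ j, 0 < a j)
    (hFle : ∀ x : Fin n → ℝ, (∀ j, x j ∈ Set.Ioc (0 : ℝ) 1) → |F x| ≤ K * fToyN a x)
    (hgge : ∀ x : Fin n → ℝ, (∀ j, x j ∈ Set.Ioc (0 : ℝ) 1) → c * gToyN a x ≤ g x)
    (x : Fin n → ℝ) (hx : ∀ j, x j ∈ Set.Ioc (0 : ℝ) 1) :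
    |F x / g x| ≤ K / c := by
  have hga : 0 < gToyN a x := gToyN_pos' a x ha fun j => (hx j).1
  have hgx : 0 < g x := lt_of_lt_of_le (mul_pos hc hga) (hgge x hx)
  rw [abs_div, abs_of_pos hgx, div_le_div_iff₀ hgx hc]
  calc |F x| * c ≤ K * fToyN a x * c := mul_le_mul_of_nonneg_right (hFle x hx) hc.le
    _ = K * (c * gToyN a x) := by rw [fToyN_eq_gToyN]; ring
    _ ≤ K * g x := mul_le_mul_of_nonneg_left (hgge x hx) hK

end SectorModel

/-! ## §3 The printed constants, and NPB 961 Theorem 3.1's exponents against the `g₃` bar -/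

/-- PRD 98 §IV E / PRD 100 §V: `D = 0.75 < 1`. [cite: Volkov2018, §IV E («D = 0.75», l.1041)] -/
theorem v18_constDeg_lt_one : (0.75 : ℝ) < 1 := by norm_num

/-- PRD 98 §IV E: `C₃ = 0.035 > 0` (PRD 100 §V «Calc 1» uses the same value). [cite: Volkov2018, §IV E («C₃ = 0.035», l.1041)] -/
theorem v18_C3_pos : (0 : ℝ) < 0.035 := by norm_num

/-- PRD 100 §V «Calc 2»: `C₃ = 0.01 > 0`. [cite: Volkov2019, §V («C₂ = 0.03, C₃ = 0.01, C₄ = 0.06, D = 0.75», l.424)] -/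
theorem v19_calc2_C3_pos : (0 : ℝ) < 0.01 := by norm_num

/-- A constant exponent `D < 1` clears the finite-second-moment bar `D < 2a` at every edge whose true exponent is `a ≥ ½` (arithmetic
helper). [folklore] -/
private theorem constDeg_lt_two_mul {D a : ℝ} (hD : D < 1) (ha : 1 / 2 ≤ a) : D < 2 * a := by linarith

/-- NPB 961 Theorem 3.1's sector exponents `max(w − ½, ½)` (`w = ⌈−ω(IClos(s^{[l]}))⌉`) clear the `g₃` bar: `0.75 < 2·max(w − ½, ½)` for
every real `w` (`Volkov2020.thm31_exponent_ge_half`). [cite: Volkov2020, Theorem 3.1 (journal p.17) with Volkov2018 §IV E «D = 0.75»] -/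
theorem v18_constDeg_lt_two_mul_thm31_exponent (w : ℝ) : (0.75 : ℝ) < 2 * max (w - 1 / 2) (1 / 2) :=
  constDeg_lt_two_mul v18_constDeg_lt_one (Volkov2020.thm31_exponent_ge_half w)

/-- **THE DERIVED GUARANTEE (sector model).** If on Ω = (0,1]ⁿ the integrand obeys a Speer-form bound `|F| ≤ K·Π d_l t_l^{d_l−1}` with every
`d_l ≥ ½` (the SHAPE of NPB 961 Theorem 3.1 / eq. (1.9) in sector coordinates) and the sampling density satisfies `g ≥ c·Π D t_l^{D−1}` with
`c > 0`, `0 < D < 1` (PRD 98 §IV E: `g ≥ C₃g₃`, `Deg ≡ D = 0.75`, `C₃ ∈ {0.035, 0.01}`), then `F²/g ∈ L¹(Ω)`: the weight has a finite second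
moment on the sector. Not printed in any of the sources; assembled from their statements. [cite: Volkov2018, §IV E (l.1006–1043); Volkov2020
Theorem 3.1 (form (1.9)); Volkov2017 §III A–B (exponent dictionary)] -/
theorem sq_div_integrable_of_speerForm_half_of_constDeg {n : ℕ} {F g : (Fin n → ℝ) → ℝ}
    (hF : AEStronglyMeasurable F (Volkov2017.cube n)) (hg : AEStronglyMeasurable g (Volkov2017.cube n))
    {K c D : ℝ} (hc : 0 < c) (hD0 : 0 < D) (hD1 : D < 1) {d : Fin n → ℝ} (hd : ∀ j, 1 / 2 ≤ d j)
    (hFle : ∀ x : Fin n → ℝ, (∀ j, x j ∈ Set.Ioc (0 : ℝ) 1) → |F x| ≤ K * Volkov2017.fToyN d x)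
    (hgge : ∀ x : Fin n → ℝ, (∀ j, x j ∈ Set.Ioc (0 : ℝ) 1) → c * Volkov2017.gToyN (fun _ => D) x ≤ g x) :
    Integrable (fun x => F x ^ 2 / g x) (Volkov2017.cube n) :=
  sq_div_integrable_of_dominated_of_constDeg hF hg hc hD0 (fun j => constDeg_lt_two_mul hD1 (hd j)) hFle hgge

end Literature.MathematicalPhysics.QuantumFieldTheory.Volkov2018

namespace Literature.MathematicalPhysics.QuantumFieldTheory.Volkov2018

/-! ## §4 Moments of every order under a mixture — the tail-index form (additions-only follow-up)

For `k ≥ 1` the weight's k-th absolute moment under its own law is `E_g|w|^k = ∫ |f/g|^k·g = ∫ |f|^k g^{1−k}`; since `t ↦ t^{1−k}` is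
antitone, `g ≥ c·g_j` transfers it from any component exactly as for `k = 2`: `E_g|w|^k ≤ c^{1−k}·E_{g_j}|w_j|^k`. In the sector model this
gives finite moments of every order `k` with `(k−1)·b_l < k·a_l` for all `l` under ANY density dominating the toy component `b` — i.e. for
`k` below `min_l b_l/(b_l − a_l)₊` (the companion's `momentN_toy_integrable_iff_tailIndex`), and for ALL `k ≥ 1` as soon as `a_l ≥ b_l`
everywhere; with the constant-exponent component (`b ≡ D = 0.75`): all moments finite once every `a_l ≥ 0.75`. -/

section Moments

variable {X : Type*}

/-- Pointwise, for `k ≥ 1`, `0 < c`, `0 < g_j`, `c·g_j ≤ g`: `|f/g|^k·g ≤ c^{1−k}·(|f/g_j|^k·g_j)` (both sides are `|f|^k` times the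
`(1−k)`-th power of the density, and `t ↦ t^{1−k}` is antitone). [cite: Owen2013, §9.11 (9.23)–(9.24) (the `k = 2` case); Volkov2018 §IV F
(«p_{j+1}/p_j < 8» footnote: third moments) for why `k > 2` matters] -/
theorem abs_div_rpow_mul_le_of_mul_le {f g gj c k : ℝ} (hk : 1 ≤ k) (hc : 0 < c) (hgj : 0 < gj) (hle : c * gj ≤ g) :
    |f / g| ^ k * g ≤ c ^ (1 - k) * (|f / gj| ^ k * gj) := by
  have hg : 0 < g := lt_of_lt_of_le (mul_pos hc hgj) hle
  have h1 : |f / g| ^ k * g = |f| ^ k * g ^ (1 - k) := by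
    rw [abs_div, abs_of_pos hg, Real.div_rpow (abs_nonneg f) hg.le, Real.rpow_sub hg, Real.rpow_one,
      div_mul_eq_mul_div, mul_div_assoc]
  have h2 : |f / gj| ^ k * gj = |f| ^ k * gj ^ (1 - k) := by
    rw [abs_div, abs_of_pos hgj, Real.div_rpow (abs_nonneg f) hgj.le, Real.rpow_sub hgj, Real.rpow_one,
      div_mul_eq_mul_div, mul_div_assoc]
  rw [h1, h2]
  have hmono : g ^ (1 - k) ≤ (c * gj) ^ (1 - k) :=
    Real.rpow_le_rpow_of_nonpos (mul_pos hc hgj) hle (by linarith)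
  rw [Real.mul_rpow hc.le hgj.le] at hmono
  calc |f| ^ k * g ^ (1 - k) ≤ |f| ^ k * (c ^ (1 - k) * gj ^ (1 - k)) :=
        mul_le_mul_of_nonneg_left hmono (Real.rpow_nonneg (abs_nonneg f) k)
    _ = c ^ (1 - k) * (|f| ^ k * gj ^ (1 - k)) := by ring

variable [MeasurableSpace X] {μ : Measure X}

/-- **k-th moment transfer from a dominated component** (`k ≥ 1`): if `c·g_j ≤ g` a.e. with `c > 0`, `g_j > 0` a.e., and `|f/g_j|^k·g_j` is
integrable, then `|f/g|^k·g` is integrable and `∫ |f/g|^k g ≤ c^{1−k}·∫ |f/g_j|^k g_j` — the mixture's weight has every absolute moment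
that the weight of ONE component has. [cite: Volkov2018, §IV E (mixture, l.1006–1043) with §IV F (moments of the sample distribution,
fn 47/48); mechanism Owen2013 §9.11] -/
theorem integrable_abs_div_rpow_mul_of_mul_le {f g gj : X → ℝ} {c k : ℝ} (hk : 1 ≤ k) (hc : 0 < c)
    (hf : AEStronglyMeasurable f μ) (hg : AEStronglyMeasurable g μ)
    (hpos : ∀ᵐ x ∂μ, 0 < gj x) (hle : ∀ᵐ x ∂μ, c * gj x ≤ g x)
    (hint : Integrable (fun x => |f x / gj x| ^ k * gj x) μ) :
    Integrable (fun x => |f x / g x| ^ k * g x) μ ∧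
      ∫ x, |f x / g x| ^ k * g x ∂μ ≤ c ^ (1 - k) * ∫ x, |f x / gj x| ^ k * gj x ∂μ := by
  have hmeas : AEStronglyMeasurable (fun x => |f x / g x| ^ k * g x) μ :=
    (((hf.aemeasurable.div hg.aemeasurable).abs.pow_const k).mul hg.aemeasurable).aestronglyMeasurable
  have hbound : ∀ᵐ x ∂μ, |f x / g x| ^ k * g x ≤ c ^ (1 - k) * (|f x / gj x| ^ k * gj x) := by
    filter_upwards [hpos, hle] with x hx hxle
    exact abs_div_rpow_mul_le_of_mul_le hk hc hx hxle
  have hnonneg : ∀ᵐ x ∂μ, 0 ≤ |f x / g x| ^ k * g x := by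
    filter_upwards [hpos, hle] with x hx hxle
    exact mul_nonneg (Real.rpow_nonneg (abs_nonneg _) k) (lt_of_lt_of_le (mul_pos hc hx) hxle).le
  have hI : Integrable (fun x => |f x / g x| ^ k * g x) μ := by
    refine Integrable.mono' (hint.const_mul (c ^ (1 - k))) hmeas ?_
    filter_upwards [hbound, hnonneg] with x hb h0
    rw [Real.norm_eq_abs, abs_of_nonneg h0]
    exact hb
  refine ⟨hI, ?_⟩
  rw [← integral_const_mul]
  exact integral_mono_ae hI (hint.const_mul _) hbound

end Moments

section SectorMoments

open Volkov2017

variable {n : ℕ}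

/-- **Moments by exponents under ANY density dominating a toy component (sector model).** On Ω = (0,1]ⁿ: `|F| ≤ K·fToyN a` (`K ≥ 0`,
`a_l > 0`), `g ≥ c·gToyN b` (`c > 0`, `b_l > 0`), `k ≥ 1` with `(k−1)·b_l < k·a_l` for every `l` ⇒ `|F/g|^k·g ∈ L¹(Ω)`: the weight has a
finite k-th absolute moment on the sector (for the exact toy and the pure toy density this is the companion's `momentN_toy_integrable_iff`,
an «iff»; `k = 2` is §2). [cite: Volkov2018, §IV E–F (l.1006–1043; octave-ratio footnotes 47/48); Volkov2017 §III A–B] -/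
theorem rpow_weight_integrable_of_dominated_of_density_ge {F g : (Fin n → ℝ) → ℝ}
    (hF : AEStronglyMeasurable F (cube n)) (hg : AEStronglyMeasurable g (cube n))
    {K c : ℝ} (hK : 0 ≤ K) (hc : 0 < c) {a b : Fin n → ℝ} (ha : ∀ j, 0 < a j) (hb : ∀ j, 0 < b j)
    {k : ℝ} (hk : 1 ≤ k) (hkab : ∀ j, (k - 1) * b j < k * a j)
    (hFle : ∀ x : Fin n → ℝ, (∀ j, x j ∈ Set.Ioc (0 : ℝ) 1) → |F x| ≤ K * fToyN a x)
    (hgge : ∀ x : Fin n → ℝ, (∀ j, x j ∈ Set.Ioc (0 : ℝ) 1) → c * gToyN b x ≤ g x) :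
    Integrable (fun x => |F x / g x| ^ k * g x) (cube n) := by
  have hmg : Measurable (gToyN b) := by
    unfold gToyN gToy
    exact Finset.measurable_prod _ fun j _ => ((measurable_pi_apply j).pow_const _).const_mul _
  -- the exact-toy k-th moment is integrable (companion file), hence so is its `K^k` multiple
  have htoy : Integrable (fun x => K ^ k * ((fToyN a x / gToyN b x) ^ k * gToyN b x)) (cube n) :=
    ((momentN_toy_integrable_iff a b ha hb k).2 hkab).const_mul _
  -- domination of |F/gToyN b|^k * gToyN b by the toy moment integrand
  have hdom : Integrable (fun x => |F x / gToyN b x| ^ k * gToyN b x) (cube n) := by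
    have hmeas : AEStronglyMeasurable (fun x => |F x / gToyN b x| ^ k * gToyN b x) (cube n) :=
      (((hF.aemeasurable.div hmg.aemeasurable).abs.pow_const k).mul hmg.aemeasurable).aestronglyMeasurable
    refine Integrable.mono' htoy hmeas (ae_mem_cube.mono fun x hx => ?_)
    have hx0 : ∀ j, 0 < x j := fun j => (hx j).1
    have hgb : 0 < gToyN b x := gToyN_pos' b x hb hx0
    have hfa : 0 ≤ fToyN a x := by
      rw [fToyN_eq_gToyN]; exact (gToyN_pos' a x ha hx0).le
    have h0 : 0 ≤ |F x / gToyN b x| ^ k * gToyN b x := mul_nonneg (Real.rpow_nonneg (abs_nonneg _) k) hgb.le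
    rw [Real.norm_eq_abs, abs_of_nonneg h0]
    have hw : |F x / gToyN b x| ≤ K * (fToyN a x / gToyN b x) := by
      rw [abs_div, abs_of_pos hgb, mul_div_assoc']
      exact div_le_div_of_nonneg_right (hFle x hx) hgb.le
    calc |F x / gToyN b x| ^ k * gToyN b x
        ≤ (K * (fToyN a x / gToyN b x)) ^ k * gToyN b x :=
          mul_le_mul_of_nonneg_right (Real.rpow_le_rpow (abs_nonneg _) hw (by linarith)) hgb.le
      _ = K ^ k * ((fToyN a x / gToyN b x) ^ k * gToyN b x) := by
          rw [Real.mul_rpow hK (div_nonneg hfa hgb.le)]; ring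
  exact (integrable_abs_div_rpow_mul_of_mul_le hk hc hF hg
    (ae_mem_cube.mono fun x hx => gToyN_pos' b x hb fun j => (hx j).1)
    (ae_mem_cube.mono fun x hx => hgge x hx) hdom).1

/-- **All moments under the constant-exponent component when the true exponents reach `D`.** If `|F| ≤ K·fToyN a` with every `a_l ≥ D > 0`
and `g ≥ c·gToyN(D,…,D)` with `c > 0`, then `|F/g|^k·g ∈ L¹(Ω)` for EVERY real `k ≥ 1` — under PRD 98's mixture (D = 0.75) a sector whose
Speer-form exponents are all `≥ 0.75` contributes finite weight moments of all orders. [cite: Volkov2018, §IV E («with same Deg(s) = D»,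
«D = 0.75», l.1024–1042)] -/
theorem rpow_weight_integrable_of_dominated_of_constDeg_le {F g : (Fin n → ℝ) → ℝ}
    (hF : AEStronglyMeasurable F (cube n)) (hg : AEStronglyMeasurable g (cube n))
    {K c D : ℝ} (hK : 0 ≤ K) (hc : 0 < c) (hD : 0 < D) {a : Fin n → ℝ} (haD : ∀ j, D ≤ a j)
    {k : ℝ} (hk : 1 ≤ k)
    (hFle : ∀ x : Fin n → ℝ, (∀ j, x j ∈ Set.Ioc (0 : ℝ) 1) → |F x| ≤ K * fToyN a x)
    (hgge : ∀ x : Fin n → ℝ, (∀ j, x j ∈ Set.Ioc (0 : ℝ) 1) → c * gToyN (fun _ => D) x ≤ g x) :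
    Integrable (fun x => |F x / g x| ^ k * g x) (cube n) :=
  rpow_weight_integrable_of_dominated_of_density_ge hF hg hK hc (fun j => lt_of_lt_of_le hD (haD j)) (fun _ => hD) hk
    (fun j => by nlinarith [haD j]) hFle hgge

end SectorMoments

/-! ## §5 The divergence direction under a mixture, by ONE edge (additions-only follow-up)

The converse of §2 for a density that is only known to be DOMINATED ABOVE near one edge — the situation of a mixture on a tube
`{x_{j₀} ∈ (0, v]} × Π_{j ≠ j₀} (u_j, v_j]`, where every Hepp-table component is `≍ x_{j₀}^{b^{(i)}_{j₀} − 1}` and so the mixture is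
`≤ K·x_{j₀}^{β − 1}` with `β = min_i b^{(i)}_{j₀}` (take `b = (β at j₀, 1 elsewhere)`, `a = (α at j₀, 1 elsewhere)` below: `gToyN b = β·x_{j₀}^{β−1}`,
`fToyN a = α·x_{j₀}^{α−1}`). If the integrand is bounded BELOW there by `c·fToyN a` with `2a_{j₀} ≤ b_{j₀}`, the weight has an infinite second
moment under the mixture — NPB 961 §1's «an underestimation of the asymptotic growth rate near the boundary even for one variable and for one
sector leads to an infinite value ∫ f²/g», now for a mixture: the underestimation must be by EVERY component on that edge (the edge exponent of
a mixture is the componentwise minimum — an EDGE statement; on multi-edge corners the minimum is taken ray by ray, §4's docstring). -/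

section MixtureDivergence

open Volkov2017

variable {n : ℕ}

/-- The toy density is measurable. [folklore] -/
private theorem measurable_gToyN₁₈ (b : Fin n → ℝ) : Measurable (gToyN b) := by
  unfold gToyN gToy
  exact Finset.measurable_prod _ fun j _ => ((measurable_pi_apply j).pow_const _).const_mul _

/-- **Infinite second moment under ANY density dominated above by a toy component near one edge.** On Ω = (0,1]ⁿ: a box
`B = Π_j (u_j, v_j] ⊆ Ω` reaching the face `x_{j₀} = 0` (`u_{j₀} = 0`), `c·fToyN a ≤ |f|` on `B` (`c > 0`, `a_j > 0`), the density positive on Ω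
and `g ≤ K·gToyN b` on `B` (`K > 0`, `b_j > 0`), and `2a_{j₀} ≤ b_{j₀}` ⇒ `f²/g ∉ L¹(Ω)`: the weight `f/g` has an infinite second moment,
whatever `f` and `g` do off the box. (For `g = gToyN b` exactly this is the companion's `sq_div_gToyN_not_integrable_of_le_on_box`; the proof
truncates `f` to `B` and compares.) [cite: Volkov2020, §1 (arXiv:1912.04885 l.121: «an underestimation of the asymptotic growth rate near
the boundary even for one variable and for one sector leads to an infinite value ∫ f(z)²/g(z) dz»); Volkov2017 §III A («if there exists j
such that b_j > 2a_j, then we fall into case 3»); applied to Volkov2018 §IV E's mixture] -/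
theorem sq_div_not_integrable_of_le_on_box_of_density_le {f g : (Fin n → ℝ) → ℝ}
    (hf : AEStronglyMeasurable f (cube n))
    {c K : ℝ} (hc : 0 < c) (hK : 0 < K) {a b : Fin n → ℝ} (ha : ∀ j, 0 < a j) (hb : ∀ j, 0 < b j)
    (u v : Fin n → ℝ) (hu : ∀ j, 0 ≤ u j) (huv : ∀ j, u j < v j) (hv : ∀ j, v j ≤ 1)
    (j₀ : Fin n) (h : 2 * a j₀ ≤ b j₀) (hu₀ : u j₀ = 0)
    (hfge : ∀ x : Fin n → ℝ, (∀ j, x j ∈ Set.Ioc (u j) (v j)) → c * fToyN a x ≤ |f x|)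
    (hgpos : ∀ x : Fin n → ℝ, (∀ j, x j ∈ Set.Ioc (0 : ℝ) 1) → 0 < g x)
    (hgle : ∀ x : Fin n → ℝ, (∀ j, x j ∈ Set.Ioc (u j) (v j)) → g x ≤ K * gToyN b x) :
    ¬ Integrable (fun x => f x ^ 2 / g x) (cube n) := by
  classical
  intro hint
  set B : Set (Fin n → ℝ) := Set.pi Set.univ fun j => Set.Ioc (u j) (v j) with hBdef
  have hBm : MeasurableSet B := MeasurableSet.univ_pi fun j => measurableSet_Ioc
  -- the truncated integrand 𝟙_B · f still has the lower bound on B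
  have hfh_meas : AEStronglyMeasurable (B.indicator f) (cube n) := hf.indicator hBm
  have hge' : ∀ x : Fin n → ℝ, (∀ j, x j ∈ Set.Ioc (u j) (v j)) → c * fToyN a x ≤ |B.indicator f x| := by
    intro x hx
    have hxB : x ∈ B := fun j _ => hx j
    rw [Set.indicator_of_mem hxB]
    exact hfge x hx
  refine sq_div_gToyN_not_integrable_of_le_on_box hc ha hb u v hu huv hv j₀ h hu₀ hge' ?_
  -- and (𝟙_B f)²/gToyN b ≤ K·f²/g on Ω, so it would be integrable
  have hmeas : AEStronglyMeasurable (fun x => B.indicator f x ^ 2 / gToyN b x) (cube n) :=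
    ((hfh_meas.aemeasurable.pow_const 2).div (measurable_gToyN₁₈ b).aemeasurable).aestronglyMeasurable
  refine Integrable.mono' (hint.const_mul K) hmeas (ae_mem_cube.mono fun x hx => ?_)
  have hx0 : ∀ j, 0 < x j := fun j => (hx j).1
  have hgb : 0 < gToyN b x := gToyN_pos' b x hb hx0
  have hgx : 0 < g x := hgpos x hx
  rw [Real.norm_eq_abs, abs_of_nonneg (div_nonneg (sq_nonneg _) hgb.le)]
  by_cases hxB : x ∈ B
  · have hx' : ∀ j, x j ∈ Set.Ioc (u j) (v j) := fun j => hxB j (Set.mem_univ j)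
    rw [Set.indicator_of_mem hxB]
    have hKg : K⁻¹ * g x ≤ gToyN b x :=
      calc K⁻¹ * g x ≤ K⁻¹ * (K * gToyN b x) := mul_le_mul_of_nonneg_left (hgle x hx') (inv_nonneg.2 hK.le)
        _ = gToyN b x := inv_mul_cancel_left₀ hK.ne' _
    calc f x ^ 2 / gToyN b x ≤ f x ^ 2 / (K⁻¹ * g x) :=
          div_le_div_of_nonneg_left (sq_nonneg _) (mul_pos (inv_pos.2 hK) hgx) hKg
      _ = K * (f x ^ 2 / g x) := by
          rw [mul_comm K⁻¹ (g x), ← div_div, div_inv_eq_mul, mul_comm]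
  · rw [Set.indicator_apply, if_neg hxB]
    have h0 : (0 : ℝ) ^ 2 / gToyN b x = 0 := by rw [zero_pow two_ne_zero, zero_div]
    rw [h0]
    exact mul_nonneg hK.le (div_nonneg (sq_nonneg _) hgx.le)

/-- **The same, whole cube** (`B = Ω`): `c·fToyN a ≤ |f|` and `0 < g ≤ K·gToyN b` on Ω with `2a_{j₀} ≤ b_{j₀}` for one `j₀` ⇒ `f²/g ∉ L¹(Ω)`.
[cite: Volkov2017, §III A («if there exists j such that b_j > 2a_j, then we fall into case 3»); Volkov2018 §IV E (mixture)] -/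
theorem sq_div_not_integrable_of_le_of_density_le {f g : (Fin n → ℝ) → ℝ}
    (hf : AEStronglyMeasurable f (cube n))
    {c K : ℝ} (hc : 0 < c) (hK : 0 < K) {a b : Fin n → ℝ} (ha : ∀ j, 0 < a j) (hb : ∀ j, 0 < b j)
    (j₀ : Fin n) (h : 2 * a j₀ ≤ b j₀)
    (hfge : ∀ x : Fin n → ℝ, (∀ j, x j ∈ Set.Ioc (0 : ℝ) 1) → c * fToyN a x ≤ |f x|)
    (hgpos : ∀ x : Fin n → ℝ, (∀ j, x j ∈ Set.Ioc (0 : ℝ) 1) → 0 < g x)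
    (hgle : ∀ x : Fin n → ℝ, (∀ j, x j ∈ Set.Ioc (0 : ℝ) 1) → g x ≤ K * gToyN b x) :
    ¬ Integrable (fun x => f x ^ 2 / g x) (cube n) :=
  sq_div_not_integrable_of_le_on_box_of_density_le hf hc hK ha hb (fun _ => 0) (fun _ => 1)
    (fun _ => le_rfl) (fun _ => zero_lt_one) (fun _ => le_rfl) j₀ h rfl hfge hgpos hgle

end MixtureDivergence

end Literature.MathematicalPhysics.QuantumFieldTheory.Volkov2018
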